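import Summits.QuantumFields.YangMills.Theorems.BalabanUVNodesN15KingModelNE2
import Summits.QuantumFields.YangMills.Theorems.BalabanUVNodesN15Knit

/-!
# Route «BalabanUVNodes» (K4 «SpineRates»), node N15 = NE2 — THE KING-MODEL RUNG, part 3: THE FIVE LEAVES OF THE UNIT-LAYER SOCKET INHABITED BY
# KING'S ACTUAL A = 0 TOWER `k ↦ Δ^{(k)}` ON EVERY TORUS — b2b's assembly `covarianceTowerRate_of_leaves` and n15-a's socket
# `N15Knit.N15unit_of_kingLeaves` FIRE on a genuine tower (not the one-site toy), all five leaves LIVE, constants explicit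

Cell `pub-ymgap`, Track A (D-0062), seat `pub-ymgap-dag-n15-d` (R134 seat, strategy s3 «King 1986 Lemma 4.5 (4.38) as the scalar kernel», gen 2;
dag-lead FAN-OUT v1.2 §N15 s3 «KING-MODEL RUNG»).  `bears_on: R4∕N15`; `--supports stmt-QuantumFields-19676` (K3).  COUNT-NEUTRAL; definition lane
(the tower, the block term, three constants and one kernel are data; every theorem is by-name plumbing of LANDED kernel theorems).

THE PRINT (template literature, PUBLISHED AND PROVED).  [King1986] = C. King, CMP **102** (1986) 649–677: Lemma 4.5 (4.38) p. 674 *«|C^{(k)}(x, y) −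
C^{(k+n)}(x, y)| ≤ CL^{−k}e^{−δ₀|x−y|}»*, proved on p. 675 from (4.33) *«C_Ω^{(k)}(s)⁻¹ ≥ γ₀I»*, (4.34) *«|C_Ω^{(k)}(s)⁻¹(x, y)| ≤ C exp[−δ₀|x−y|]»*,
Lemma 4.3 (4.18) p. 672 through (4.35), and the lattice sum (4.41) *«Σ_{z,w∈Ω} exp[−δ₀|x−z| − δ₀|z−w| − δ₀|w−y|] ≤ CL^{−k}exp[−δ₀|x−y|]»*.  In the
tree these four printed inputs are KERNEL THEOREMS for King's ACTUAL operators on every torus `Π_μ ℤ∕(LM_μ)` (`King1986.CovarianceRateTorus` §2–§3,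
`King1986.Torus.king433`, `UniformDecay`), and the MECHANISM (4.39)–(4.41) is typed TWICE: as `King1986.lemma45_of_supRate` (consumed by
`king_lemma45_torus`, parts 1–2 of this rung) and, one level up, as b2b's TOWER ASSEMBLY `Spine.NE2KingTransplant.covarianceTowerRate_of_leaves` over
five typed leaves — (H1) `UniformCoercive`, (H2) `UniformCTBound`, (H2′) `UniformKernelDecay`, (H3) `EffectiveOperatorSupRate`, (H4) `VolumeSum` —
which n15-a's `BalabanUVNodesN15Knit.N15unit_of_kingLeaves` transplants to the node's typed unit conjunct `T4EtaRate.NE2PlusUnit` on ANY background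
carrier family.  Before this file the five leaves were inhabited in the tree ONLY by the one-site toy tower of `Spine.NE2KingTransplantWitness`
(index `Unit`, `d ≡ 0`, `B = 0`).

CONTENTS (0 sorry).  §1 KING'S TOWER on the unit lattice `Π_μ ℤ∕(LM_μ)` of ANY torus in ANY dimension: `kingLevel j = Δ^{(j)}` (`King1986.Torus.effLaplacian`
BY NAME at `N = L^j`, `a_j = aK a L j`), `kingTower = (j ↦ Δ^{(max j 1)})` (King's `a_k` (2.13) is printed for `k ≥ 1`; the ℕ-indexed tower of the
socket is King's from level 1 on and CONSTANT below it — SAID; `kingTower_of_one_le`, `kingTower_zero`), `kingBlock = aL⁻²Q*Q` (`blockProj`),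
`effLaplacian_congrN`, `isPseudoMetric_tdistT`.
§2 THE FIVE LEAVES, constants those of `CovarianceRateTorus` §3: **`uniformCoercive_kingTower`** ((H1), `γ₀ = gam0L`: `king433`) ·
**`uniformCTBound_kingTower`** ((H2), `κ = kapCT`, `ρ = kingRho`, `ρ_B = kingRhoB`: `effLaplacian_entry_le_unif` + `blockTerm_entry_le` through
`B4Sect5Torus.weightedRowSum_le ∕ weightedColSum_le`) · `kingRho_add_le` (`ρ + ρ_B ≤ γ₀∕2`: `rate_mul_weightC_le`) · **`uniformKernelDecay_kingTower`**
((H2′), `C₁ = CDelU`, rate `2κ ≤ κ_U`) · **`effectiveOperatorSupRate_kingTower`** ((H3), `ε = θ̄·a`, `r = L⁻²`: `effLaplacian_sub_apply_le` + `thetaK_le` =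
Lemma 4.3 through (4.35); the bottom step `Δ^{(1)} − Δ^{(1)} = 0`) · **`volumeSum_kingTorus`** ((H4), `V = V45`: `tdistT_sumBound`) · `V45_pos` · `kingLeaves`.
§3 THE ROOT THROUGH THE ASSEMBLY: **`covarianceTowerRate_kingTower`** = `covarianceTowerRate_of_leaves` FIRED on King's tower — (4.38) in the typed ONE-STEP
tower form `|(Δ^{(k)}+B)⁻¹(x,y) − (Δ^{(k+1)}+B)⁻¹(x,y)| ≤ C_K·(L⁻¹)^k·e^{−δ₄₅|x−y|_T}` at EVERY level, `C_K = kingC ≤ K₄₅` (`kingC_le_K45`), SAME decay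
`δ₄₅` and SAME rate `L⁻¹` as `king_lemma45_torus` — the two kernel routes AGREE (`kingCov_oneStep_rate`: part 1's `kingCov` BY NAME).  §4 THE SOCKET
FIRES: `kingCov_congrN`, `kingKer1` (the one-step unit kernel `C^{(k+1)} − C^{(k)}` on part 1's King family `kingInstance`; `kingKer1_eq_kingKer`: it IS part 1's kernel at
shift `n = 1`), **`ne2PlusUnit_king_of_socket`** = `N15unit_of_kingLeaves` applied with `e = id`, `dm = tdistT`, `D_i = kingTower`, `B_i = kingBlock`,
ALL FIVE LEAVES DISCHARGED at every index and every (one-point) background ⇒ `NE2PlusUnit c35 kingInstance kingKer1 ⊤ tdistT` BY NAME; `ne2ZeroUnit_king_of_socket`.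

WHY (what this adds to parts 1–2).  Part 2 read the node's unit layer on Lemma 4.5's CONCLUSION; this part inhabits the socket's HYPOTHESES by the
tower they were abstracted from, on every torus: (i) the NE2 unit-layer interface of record (`N15unit_of_kingLeaves` ∘ `covarianceTowerRate_of_leaves`)
is JOINTLY SATISFIABLE by a genuine `(d+1)`-dimensional tower with decay, Combes–Thomas weights, a non-zero block term and a geometric two-spacing
leaf — its only previous inhabitant was the one-site toy; (ii) the «what the curved case adds» line of part 2 becomes a typed CHECKLIST with the
model's constants displayed: at a background `U` the same five predicates of `Δ^{(k)}(U)`, `B(U)` are the obligations — (H1)∕(H2)∕(H2′)∕(H4) one-run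
bounds of printed KIND ([B9] Thm 3.15 (3.187), [B6] Lemma 2.1), (H3) the two-spacing sup-rate of `Δ^{(k)}(U)` = NOT PRINTED (N16's `LocalRate`).

HONEST FRAMING ∕ LIMITS.  King's `A = 0` SCALAR MODEL, periodic b.c., flat blocks, `m² > 0`, `L ≥ 2`, levels `k ≥ 1` (level 0 of the ℕ-tower :=
level 1) — NOT Bałaban's `C^{(k)}(Λ; U)`, `G(U)`, `ℋ(U)`, NOT the carriers of record (NODE 00); nothing of [B9] is asserted; the operator ∕ site layers
are parts 1–2's (unchanged); NOT a node discharge; typed 28∕28, discharged count untouched; one finite torus programme at fixed ε — NOT ℝ⁴ ∕ infinite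
volume ∕ OS ∕ mass gap ∕ Clay.  Locators only: [King1986] (2.13) p. 653, Lemma 4.3 (4.18) p. 672, (4.32)–(4.35) p. 674, Lemma 4.5 (4.38) p. 674,
(4.39)–(4.41) p. 675; [B9] = [Balaban1985BackgroundPropagators] Thm 3.15 (3.187) p. 432 (quantifier template); [B6] = [Balaban1984PropagatorsII]
Lemma 2.1 (2.61) p. 234.
-/

noncomputable section

open scoped BigOperators
open Finset

namespace Summit.QuantumFields.YangMills.BalabanUVNodes.N15.KingModel

open Literature.MathematicalPhysics.QuantumFieldTheory.Balaban1983to89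
open Literature.MathematicalPhysics.QuantumFieldTheory.Balaban1983to89.QGQInverse (Coercive)
open Literature.MathematicalPhysics.QuantumFieldTheory.Balaban1983to89.B4Sect5Torus (IsPseudoDist SumBound weightC weightedRowSum_le
  weightedColSum_le rate_mul_weightC_le)
open Literature.MathematicalPhysics.QuantumFieldTheory.Balaban1983to89.B5Prop11Plancherel (Tor fine)
open Literature.MathematicalPhysics.QuantumFieldTheory.Balaban1983to89.T4EtaRate (PairedInstance NE2PlusUnit)
open Literature.MathematicalPhysics.QuantumFieldTheory.Balaban1983to89.T4EtaRateDefectSite (pt9Bg)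
open Literature.MathematicalPhysics.QuantumFieldTheory.Balaban1983to89.T4EtaRateUnitWitness (NE2ZeroUnit ne2ZeroUnit_of_ne2PlusUnit)
open Literature.MathematicalPhysics.QuantumFieldTheory.King1986 (aK wRow wCol exp_decay_mono thetaK)
open Literature.MathematicalPhysics.QuantumFieldTheory.King1986.Torus (effLaplacian blockProj tdistT tdistT_isPseudoDist tdistT_sumBound aminL
  aminL_pos aminL_le_aK kapU kapU_pos_le CDelU CDelU_pos effLaplacian_entry_le_unif blockTerm_entry_le gam0L gam0L_pos cB cB_nonneg kapCT
  kapCT_pos_le V45 thetaBar K45 delta45 delta45_pos K45_nonneg latticeConst_profile_nonneg thetaK_le effLaplacian_sub_apply_le king433)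
open Summit.QuantumFields.BalabanUV.T4Continuum.NE2KingTransplant (IsPseudoMetric UniformCoercive UniformCTBound UniformKernelDecay
  EffectiveOperatorSupRate VolumeSum CovarianceTowerRate covarianceTowerRate_of_leaves)
open Summit.QuantumFields.YangMills.Theorems.BalabanUVNodesN15Knit (N15unit_of_kingLeaves)

/-! ## §1 King's tower of effective Laplacians on the unit lattice of a torus, the block term, the torus pseudo-metric -/

section Tower

variable {dd : ℕ} (a m2 : ℝ) (L : ℕ) [NeZero L] (M : Fin dd → ℕ) [∀ μ, NeZero (M μ)]

/-- LEVEL `j` OF KING'S TOWER: the effective Laplacian `Δ^{(j)} = a_j − a_j²N^dQ(N²(−Δ)+m²+a_jQᵀQ)⁻¹Qᵀ` on the unit lattice `Π_μ ℤ∕(LM_μ)` with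
`N = L^j` fine points per unit side and King's `a_j = aK a L j` (BY NAME: `King1986.Torus.effLaplacian`, `King1986.aK`). [cite: King1986, (2.13)–(2.14) p.653, (4.5) p.670] -/
def kingLevel (j : ℕ) : Matrix (Tor (fine L M)) (Tor (fine L M)) ℝ :=
  effLaplacian (L ^ j) (fine L M) (aK a L j) (((L ^ j : ℕ) : ℝ) ^ 2) m2

/-- KING'S TOWER as an ℕ-indexed tower (the shape the socket consumes): level `max j 1` — King's `a_k` (2.13) is printed for `k ≥ 1` only, so the
tower is King's from level 1 on and constant below it. [cite: King1986, (2.13) p.653, (4.32) p.674] -/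
def kingTower : ℕ → Matrix (Tor (fine L M)) (Tor (fine L M)) ℝ := fun j => kingLevel a m2 L M (max j 1)

/-- THE BLOCK TERM `B = aL⁻²Q*Q` of (4.32) (BY NAME: `King1986.Torus.blockProj`). [cite: King1986, (4.32) p.674] -/
def kingBlock : Matrix (Tor (fine L M)) (Tor (fine L M)) ℝ := (a * ((L : ℝ) ^ 2)⁻¹) • blockProj L M

variable {a m2 L M}

/-- From level 1 on the tower is King's: `kingTower j = Δ^{(j)}` for `j ≥ 1`. [folklore] -/
theorem kingTower_of_one_le {j : ℕ} (hj : 1 ≤ j) : kingTower a m2 L M j = kingLevel a m2 L M j := by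
  simp only [kingTower, max_eq_left hj]

/-- Level 0 of the ℕ-tower is level 1. [folklore] -/
theorem kingTower_zero : kingTower a m2 L M 0 = kingLevel a m2 L M 1 := by
  simp only [kingTower, Nat.zero_max]

/-- The effective Laplacian does not depend on how its number of fine points is written (ℕ-equal `N`, equal masses `c`). [folklore] -/
theorem effLaplacian_congrN {N N' : ℕ} [NeZero N] [NeZero N'] (h : N = N') (K : Fin dd → ℕ) [∀ μ, NeZero (K μ)] (a₁ c c' m : ℝ)
    (hc : c = c') : effLaplacian N K a₁ c m = effLaplacian N' K a₁ c' m := by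
  subst h; subst hc; rfl

/-- King's periodic distance `|x − y|_T` on the unit lattice is a pseudo-metric in the socket's sense. [folklore] -/
theorem isPseudoMetric_tdistT (K : Fin dd → ℕ) [∀ μ, NeZero (K μ)] : IsPseudoMetric (tdistT K) :=
  ⟨(tdistT_isPseudoDist K).symm, (tdistT_isPseudoDist K).zero, (tdistT_isPseudoDist K).triangle⟩

end Tower

/-! ## §2 The five leaves for King's tower, constants explicit (those of `King1986.CovarianceRateTorus` §3) -/

section Leaves

/-- THE COMBES–THOMAS ROW∕COLUMN-SUM CONSTANT of the effective Laplacians: `ρ = κ′·M₀(C_U, κ_U)` (`κ′ = kapCT`, `M₀ = B4Sect5Torus.weightC`).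
[cite: King1986, (4.34) p.674] -/
def kingRho (dd : ℕ) (a : ℝ) (L : ℕ) : ℝ :=
  kapCT dd a L * weightC (B4Sect5Proof.latticeConst dd) (CDelU dd a (aminL a L)) (kapU dd a (aminL a L))

/-- THE COMBES–THOMAS ROW∕COLUMN-SUM CONSTANT of the block term: `ρ_B = κ′·M₀(c_B, κ_U)`. [cite: King1986, (4.34) p.674] -/
def kingRhoB (dd : ℕ) (a : ℝ) (L : ℕ) : ℝ :=
  kapCT dd a L * weightC (B4Sect5Proof.latticeConst dd) (cB dd a L) (kapU dd a (aminL a L))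

/-- THE TOWER CONSTANT of (4.38) produced by the socket's assembly: `C_K = √(2θ̄aC_U)·(γ₀ − ρ − ρ_B)⁻²·V²`. [cite: King1986, (4.41) p.675] -/
def kingC (dd : ℕ) (a : ℝ) (L : ℕ) : ℝ :=
  Real.sqrt (thetaBar a L * a * (2 * CDelU dd a (aminL a L))) * ((gam0L dd a L - (kingRho dd a L + kingRhoB dd a L))⁻¹) ^ 2
    * V45 dd a L ^ 2

variable {dd : ℕ} {a m2 : ℝ} {L : ℕ} [NeZero L] {M : Fin dd → ℕ} [∀ μ, NeZero (M μ)]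

/-- **LEAF (H1) FOR KING'S TOWER — uniform endpoint coercivity (4.33)**: `Δ^{(max j 1)} + aL⁻²Q*Q ≥ γ₀ = gam0L(a, L, d)` at EVERY level `j`, on every torus
(`L ≥ 2`, `a, m² > 0`; BY NAME: `King1986.Torus.king433`). [cite: King1986, (4.33) p.674] -/
theorem uniformCoercive_kingTower (ha : 0 < a) (hm : 0 < m2) (hL : 2 ≤ L) :
    UniformCoercive (kingTower a m2 L M) (kingBlock a L M) (gam0L dd a L) := by
  intro j
  have hamin := aminL_pos ha hL
  obtain ⟨hak1, -⟩ := aminL_le_aK ha hL (le_max_right j 1)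
  exact (king433 L M (by omega) hamin ha hak1 hak1 (L ^ max j 1) (L ^ max j 1) hm hm).1

/-- The (4.34) decay of every level of the tower at the common rate `κ_U` with the common constant `C_U` (BY NAME: `effLaplacian_entry_le_unif`).
[cite: King1986, (4.34) p.674] -/
theorem kingTower_entry_le (ha : 0 < a) (hm : 0 < m2) (hL : 2 ≤ L) (j : ℕ) (z w : Tor (fine L M)) :
    |kingTower a m2 L M j z w| ≤ CDelU dd a (aminL a L) * Real.exp (-(kapU dd a (aminL a L) * tdistT (fine L M) z w)) := by
  obtain ⟨h1, h2⟩ := aminL_le_aK ha hL (le_max_right j 1)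
  exact effLaplacian_entry_le_unif ha (aminL_pos ha hL) h1 h2 hm (L ^ max j 1) (fine L M) z w

/-- The (4.34)-form short range of the block term (BY NAME: `blockTerm_entry_le`). [cite: King1986, p.674 («Q*Q is a short-range operator»)] -/
theorem kingBlock_entry_le (ha : 0 < a) (hL : 2 ≤ L) (z w : Tor (fine L M)) :
    |kingBlock a L M z w| ≤ cB dd a L * Real.exp (-(kapU dd a (aminL a L) * tdistT (fine L M) z w)) :=
  blockTerm_entry_le L M ha.le (kapU_pos_le (d := dd) ha (aminL_pos ha hL)).1.le z w

/-- **LEAF (H2) FOR KING'S TOWER — uniform Combes–Thomas summability (4.34)**: the weighted off-diagonal row and column sums at rate `κ′ = kapCT` of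
every `Δ^{(max j 1)}` are `≤ ρ = kingRho` and of `aL⁻²Q*Q` are `≤ ρ_B = kingRhoB` (BY NAME: `B4Sect5Torus.weightedRowSum_le ∕ weightedColSum_le` on
`effLaplacian_entry_le_unif`, `blockTerm_entry_le`). [cite: King1986, (4.34) p.674; Balaban1983RegularityDecay, Sect. 5 (the engine)] -/
theorem uniformCTBound_kingTower (ha : 0 < a) (hm : 0 < m2) (hL : 2 ≤ L) :
    UniformCTBound (kingTower a m2 L M) (kingBlock a L M) (tdistT (fine L M)) (kapCT dd a L) (kingRho dd a L) (kingRhoB dd a L) := by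
  have hamin := aminL_pos ha hL
  obtain ⟨hκU0, -⟩ := kapU_pos_le (d := dd) ha hamin
  have hCU0 := CDelU_pos (d := dd) ha hamin
  have hcb0 : 0 ≤ cB dd a L := cB_nonneg ha.le L
  obtain ⟨hκ'0, hκ'U⟩ := kapCT_pos_le (d := dd) ha hL
  have hpd := tdistT_isPseudoDist (fine L M)
  have hSB := tdistT_sumBound (fine L M)
  have hD := kingTower_entry_le (M := M) ha hm hL
  have hB := kingBlock_entry_le (M := M) ha hL
  refine ⟨fun j i => ?_, fun j i => ?_, fun i => ?_, fun i => ?_⟩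
  · exact weightedRowSum_le hpd.nonneg hSB _ hCU0.le hκU0 hκ'0.le hκ'U (hD j) i
  · exact weightedColSum_le hpd hSB _ hCU0.le hκU0 hκ'0.le hκ'U (hD j) i
  · exact weightedRowSum_le hpd.nonneg hSB _ hcb0 hκU0 hκ'0.le hκ'U hB i
  · exact weightedColSum_le hpd hSB _ hcb0 hκU0 hκ'0.le hκ'U hB i

omit [NeZero L] in
/-- `ρ + ρ_B ≤ γ₀∕2` (the choice of `κ′` in `B4Sect5Torus.rate`; BY NAME: `rate_mul_weightC_le`). [folklore] -/
theorem kingRho_add_le (ha : 0 < a) (hL : 2 ≤ L) : kingRho dd a L + kingRhoB dd a L ≤ gam0L dd a L / 2 := by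
  have hamin := aminL_pos ha hL
  obtain ⟨hκU0, -⟩ := kapU_pos_le (d := dd) ha hamin
  have hCU0 := CDelU_pos (d := dd) ha hamin
  have hcb0 : 0 ≤ cB dd a L := cB_nonneg ha.le L
  have hlin : kingRho dd a L + kingRhoB dd a L
      = kapCT dd a L * weightC (B4Sect5Proof.latticeConst dd) (CDelU dd a (aminL a L) + cB dd a L) (kapU dd a (aminL a L)) := by
    unfold kingRho kingRhoB weightC; ring
  rw [hlin]
  exact rate_mul_weightC_le (latticeConst_profile_nonneg dd) (gam0L_pos ha hL) (add_nonneg hCU0.le hcb0) hκU0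

omit [NeZero L] in
/-- `ρ + ρ_B < γ₀` — the hypothesis of the assembly. [folklore] -/
theorem kingRho_add_lt_gam0L (ha : 0 < a) (hL : 2 ≤ L) : kingRho dd a L + kingRhoB dd a L < gam0L dd a L := by
  have := kingRho_add_le (dd := dd) ha hL
  have := gam0L_pos (d := dd) ha hL
  linarith

/-- **LEAF (H2′) FOR KING'S TOWER — uniform pointwise decay at the doubled Combes–Thomas rate**: `|Δ^{(max j 1)}(z, w)| ≤ C_U·e^{−2κ′|z−w|_T}`
(`2κ′ ≤ κ_U∕2`). [cite: King1986, (4.34) p.674 and p.675 («the uniform exponential decay of Δ^{(k)}»)] -/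
theorem uniformKernelDecay_kingTower (ha : 0 < a) (hm : 0 < m2) (hL : 2 ≤ L) :
    UniformKernelDecay (kingTower a m2 L M) (tdistT (fine L M)) (CDelU dd a (aminL a L)) (kapCT dd a L) := by
  intro j z w
  have hamin := aminL_pos ha hL
  obtain ⟨-, hκ'U⟩ := kapCT_pos_le (d := dd) ha hL
  obtain ⟨hκU0, -⟩ := kapU_pos_le (d := dd) ha hamin
  have h2κ : 2 * kapCT dd a L ≤ kapU dd a (aminL a L) := by linarith
  exact (kingTower_entry_le ha hm hL j z w).trans
    (exp_decay_mono (CDelU_pos (d := dd) ha hamin).le h2κ ((tdistT_isPseudoDist (fine L M)).nonneg z w))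

omit [NeZero L] in
/-- `θ̄·a ≥ 0`. [folklore] -/
theorem thetaBar_mul_nonneg (ha : 0 < a) (hL : 2 ≤ L) : 0 ≤ thetaBar a L * a := by
  have := aminL_pos ha hL
  unfold thetaBar
  positivity

/-- **LEAF (H3) FOR KING'S TOWER — the one-step sup-norm rate of the effective operators, geometric**: `|Δ^{(j+1)}(z,w) − Δ^{(j)}(z,w)| ≤ (θ̄a)·(L⁻²)^j`
for `j ≥ 1` (Lemma 4.3 (4.18) through the plane-wave form (4.35), BY NAME: `effLaplacian_sub_apply_le`, `thetaK_le`), and `0` at the constant bottom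
step. [cite: King1986, Lemma 4.3 (4.18) p.672, (4.35) p.674] -/
theorem effectiveOperatorSupRate_kingTower (ha : 0 < a) (hm : 0 < m2) (hL : 2 ≤ L) :
    EffectiveOperatorSupRate (kingTower a m2 L M) (thetaBar a L * a) (((L : ℝ) ^ 2)⁻¹) := by
  intro j z w
  have hθ0 := thetaBar_mul_nonneg ha hL
  rcases Nat.eq_zero_or_pos j with rfl | hj
  · rw [zero_add, kingTower_of_one_le le_rfl, kingTower_zero, sub_self, Matrix.zero_apply, abs_zero, pow_zero, mul_one]
    exact hθ0
  · have hj1 : 1 ≤ j := hj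
    have hN : L ^ 1 * L ^ j = L ^ (j + 1) := by ring
    have hlev : kingLevel a m2 L M (j + 1)
        = effLaplacian (L ^ 1 * L ^ j) (fine L M) (aK a L (j + 1)) (((L ^ 1 * L ^ j : ℕ) : ℝ) ^ 2) m2 :=
      effLaplacian_congrN hN.symm (fine L M) _ _ _ _ (by rw [hN])
    have e : (((L : ℝ) ^ j) ^ 2)⁻¹ = (((L : ℝ) ^ 2)⁻¹) ^ j := by
      rw [inv_pow, ← pow_mul, ← pow_mul, mul_comm]
    rw [kingTower_of_one_le (by omega : 1 ≤ j + 1), kingTower_of_one_le hj1, Matrix.sub_apply, hlev]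
    calc |effLaplacian (L ^ 1 * L ^ j) (fine L M) (aK a L (j + 1)) (((L ^ 1 * L ^ j : ℕ) : ℝ) ^ 2) m2 z w
            - kingLevel a m2 L M j z w|
        ≤ thetaK a L j 1 * a := effLaplacian_sub_apply_le ha hm hL hj1 le_rfl M z w
      _ ≤ thetaBar a L * (((L : ℝ) ^ j) ^ 2)⁻¹ * a := mul_le_mul_of_nonneg_right (thetaK_le ha hL hj1 le_rfl) ha.le
      _ = thetaBar a L * a * (((L : ℝ) ^ 2)⁻¹) ^ j := by rw [e]; ring

/-- **LEAF (H4) ON KING'S TORUS — the volume-independent lattice sum (4.41)**: `Σ_z e^{−(κ′∕2)|x−z|_T} ≤ V = V45(a, L, d)` on every torus (BY NAME: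
`tdistT_sumBound` = `B4Sect5Torus.torusSum_le`). [cite: King1986, (4.41) p.675] -/
theorem volumeSum_kingTorus (ha : 0 < a) (hL : 2 ≤ L) : VolumeSum (tdistT (fine L M)) (kapCT dd a L) (V45 dd a L) := fun x =>
  tdistT_sumBound (fine L M) (kapCT dd a L / 2) (half_pos (kapCT_pos_le (d := dd) ha hL).1) x

omit [NeZero L] in
/-- `V > 0` (the lattice sum of (H4) contains the term `z = x`; read on the one-point-per-direction torus). [folklore] -/
theorem V45_pos (dd : ℕ) (ha : 0 < a) (hL : 2 ≤ L) : 0 < V45 dd a L := by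
  have hκ := half_pos (kapCT_pos_le (d := dd) ha hL).1
  have h := tdistT_sumBound (fun _ : Fin dd => (1 : ℕ)) (kapCT dd a L / 2) hκ 0
  have h1 : (1 : ℝ) ≤ ∑ y : Tor (fun _ : Fin dd => (1 : ℕ)),
      Real.exp (-(kapCT dd a L / 2 * tdistT (fun _ : Fin dd => (1 : ℕ)) 0 y)) := by
    have hs := Finset.single_le_sum (s := Finset.univ)
      (f := fun y : Tor (fun _ : Fin dd => (1 : ℕ)) => Real.exp (-(kapCT dd a L / 2 * tdistT (fun _ : Fin dd => (1 : ℕ)) 0 y)))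
      (fun y _ => (Real.exp_pos _).le) (Finset.mem_univ 0)
    rwa [(tdistT_isPseudoDist (fun _ : Fin dd => (1 : ℕ))).zero, mul_zero, neg_zero, Real.exp_zero] at hs
  exact lt_of_lt_of_le one_pos (h1.trans h)

/-- **THE FIVE LEAVES AT ONCE** (with the pseudo-metric): everything `covarianceTowerRate_of_leaves` ∕ `N15unit_of_kingLeaves` ask of a tower, for
King's actual tower on every torus (`L ≥ 2`, `a, m² > 0`). [cite: King1986, (4.33)–(4.34) p.674, Lemma 4.3 (4.18) p.672, (4.41) p.675] -/
theorem kingLeaves (ha : 0 < a) (hm : 0 < m2) (hL : 2 ≤ L) :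
    IsPseudoMetric (tdistT (fine L M)) ∧
      UniformCoercive (kingTower a m2 L M) (kingBlock a L M) (gam0L dd a L) ∧
      UniformCTBound (kingTower a m2 L M) (kingBlock a L M) (tdistT (fine L M)) (kapCT dd a L) (kingRho dd a L) (kingRhoB dd a L) ∧
      UniformKernelDecay (kingTower a m2 L M) (tdistT (fine L M)) (CDelU dd a (aminL a L)) (kapCT dd a L) ∧
      EffectiveOperatorSupRate (kingTower a m2 L M) (thetaBar a L * a) (((L : ℝ) ^ 2)⁻¹) ∧
      VolumeSum (tdistT (fine L M)) (kapCT dd a L) (V45 dd a L) :=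
  ⟨isPseudoMetric_tdistT (fine L M), uniformCoercive_kingTower ha hm hL, uniformCTBound_kingTower ha hm hL,
    uniformKernelDecay_kingTower ha hm hL, effectiveOperatorSupRate_kingTower ha hm hL, volumeSum_kingTorus ha hL⟩

end Leaves

/-! ## §3 The root through the socket's assembly: (4.38) in the one-step tower form at every level -/

section Root

variable {dd : ℕ} {a m2 : ℝ} {L : ℕ} [NeZero L] {M : Fin dd → ℕ} [∀ μ, NeZero (M μ)]

/-- **`covarianceTowerRate_of_leaves` FIRED ON KING'S TOWER — Lemma 4.5 (4.38) re-derived THROUGH THE TYPED ASSEMBLY**: on every torus, for every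
level `k` and all sites, `|(Δ^{(max k 1)} + aL⁻²Q*Q)⁻¹(x, y) − (Δ^{(k+1)} + aL⁻²Q*Q)⁻¹(x, y)| ≤ C_K·(L⁻¹)^k·e^{−δ₄₅|x−y|_T}` with `C_K = kingC`, the decay
`δ₄₅ = κ′∕2` and the rate `L⁻¹ = √(L⁻²)` of `king_lemma45_torus` (`L ≥ 2`, `a, m² > 0`). [cite: King1986, Lemma 4.5 (4.38) p.674, (4.39)–(4.41) p.675] -/
theorem covarianceTowerRate_kingTower (ha : 0 < a) (hm : 0 < m2) (hL : 2 ≤ L) :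
    CovarianceTowerRate (kingTower a m2 L M) (kingBlock a L M) (tdistT (fine L M)) (kingC dd a L) (delta45 dd a L) ((L : ℝ)⁻¹) := by
  have h := covarianceTowerRate_of_leaves (kingTower a m2 L M) (kingBlock a L M) (tdistT (fine L M)) (isPseudoMetric_tdistT (fine L M))
    (kingRho_add_lt_gam0L (dd := dd) ha hL) (kapCT_pos_le (d := dd) ha hL).1.le (thetaBar_mul_nonneg ha hL) (by positivity)
    (uniformCoercive_kingTower ha hm hL) (uniformCTBound_kingTower ha hm hL) (uniformKernelDecay_kingTower ha hm hL)
    (effectiveOperatorSupRate_kingTower ha hm hL) (volumeSum_kingTorus ha hL)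
  have hsq : Real.sqrt (((L : ℝ) ^ 2)⁻¹) = (L : ℝ)⁻¹ := by
    rw [Real.sqrt_inv, Real.sqrt_sq (by positivity)]
  intro k x y
  have hk := h k x y
  rw [hsq] at hk
  exact hk

omit [NeZero L] in
/-- `C_K ≤ K₄₅` — the assembly's constant is at most the constant of `king_lemma45_torus` (`(γ₀ − ρ − ρ_B)⁻¹ ≤ 2∕γ₀`). [folklore] -/
theorem kingC_le_K45 (ha : 0 < a) (hL : 2 ≤ L) : kingC dd a L ≤ K45 dd a L := by
  have hγ := gam0L_pos (d := dd) ha hL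
  have hρ := kingRho_add_le (dd := dd) ha hL
  have hinv0 : 0 ≤ (gam0L dd a L - (kingRho dd a L + kingRhoB dd a L))⁻¹ := inv_nonneg.mpr (by linarith)
  have hinv : (gam0L dd a L - (kingRho dd a L + kingRhoB dd a L))⁻¹ ≤ 2 / gam0L dd a L := by
    rw [div_eq_mul_inv, show (2 : ℝ) * (gam0L dd a L)⁻¹ = (gam0L dd a L / 2)⁻¹ by rw [inv_div]; ring]
    exact inv_anti₀ (by positivity) (by linarith)
  unfold kingC K45
  gcongr

/-- **THE TWO KERNEL ROUTES AGREE — the one-step rate for part 1's `C^{(k)}` BY NAME**: for `k ≥ 1` and all sites of every torus,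
`|C^{(k)}(x, y) − C^{(k+1)}(x, y)| ≤ C_K·(L⁻¹)^k·e^{−δ₄₅|x−y|_T}` with `C^{(k)} = kingCov … (L^k) k` of part 1 (`C_K ≤ K₄₅`, same `δ₄₅`, same `L^{−k}` as
`king_lemma45_torus` at `n = 1`). [cite: King1986, Lemma 4.5 (4.38) p.674] -/
theorem kingCov_oneStep_rate {d : ℕ} (ha : 0 < a) (hm : 0 < m2) (hL : 2 ≤ L) (M : Fin (d + 1) → ℕ) [∀ μ, NeZero (M μ)] {k : ℕ}
    (hk : 1 ≤ k) (x y : Tor (fine L M)) :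
    |kingCov L M a m2 (L ^ k) k x y - kingCov L M a m2 (L ^ (k + 1)) (k + 1) x y|
      ≤ kingC (d + 1) a L * ((L : ℝ)⁻¹) ^ k * Real.exp (-(delta45 (d + 1) a L * tdistT (fine L M) x y)) := by
  have h := covarianceTowerRate_kingTower (M := M) ha hm hL k x y
  rw [kingTower_of_one_le hk, kingTower_of_one_le (by omega : 1 ≤ k + 1)] at h
  exact h

end Root

/-! ## §4 The socket fires: `N15unit_of_kingLeaves` on the King family -/

section Socket

variable {d : ℕ} {L : ℕ} [NeZero L] {a m2 : ℝ}

/-- Part 1's `kingCov` does not depend on how the number of fine points is written. [folklore] -/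
theorem kingCov_congrN (M : Fin (d + 1) → ℕ) [∀ μ, NeZero (M μ)] {N N' : ℕ} [NeZero N] [NeZero N'] (h : N = N') (lvl : ℕ) :
    kingCov L M a m2 N lvl = kingCov L M a m2 N' lvl := by
  subst h; rfl

/-- THE ONE-STEP UNIT KERNEL on part 1's King family: at index `i` (torus `M`, scales `k ≥ 1`), configuration-independent,
`(y, y′) ↦ C^{(k+1)}(y, y′) − C^{(k)}(y, y′)` — the shape `N15unit_of_kingLeaves` asks of a unit kernel (`D (k+1) + B` against `D k + B`).
[cite: King1986, Lemma 4.5 (4.38) p.674 (the differenced object at n = 1)] -/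
def kingKer1 (a m2 : ℝ) (i : KingIndex d L) : B9.SiteKernel (kingInstance i).gc (kingInstance i).Bf :=
  ⟨fun _ y y' => kingCov L i.Mn a m2 (L ^ (i.k + 1)) (i.k + 1) y y' - kingCov L i.Mn a m2 (L ^ i.k) i.k y y'⟩

/-- At shift `n = 1` the one-step kernel IS part 1's kernel `kingKer` (`L^1·L^k = L^{k+1}`). [folklore] -/
theorem kingKer1_eq_kingKer (i : KingIndex d L) (hn : i.n = 1) : (kingKer1 a m2 i).ker = (kingKer a m2 i).ker := by
  funext U y y'
  show kingCov L i.Mn a m2 (L ^ (i.k + 1)) (i.k + 1) y y' - kingCov L i.Mn a m2 (L ^ i.k) i.k y y'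
    = kingCov L i.Mn a m2 (L ^ i.n * L ^ i.k) (i.k + i.n) y y' - kingCov L i.Mn a m2 (L ^ i.k) i.k y y'
  have hN : L ^ (i.k + 1) = L ^ i.n * L ^ i.k := by rw [hn]; ring
  rw [kingCov_congrN i.Mn hN, hn]

/-- **THE SOCKET FIRES ON THE KING FAMILY — `NE2PlusUnit` BY NAME through `N15unit_of_kingLeaves`, ALL FIVE LEAVES LIVE** (every `c35`; torus
dimension `d + 1`, `L ≥ 2`, `a, m² > 0`): on part 1's family `kingInstance` (index = torus `M`, `k ≥ 1`, shift, direction, free size parameter), with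
the one-step unit kernel `kingKer1`, `inΛ := ⊤`, `unitDist := tdistT`, the socket's data are `e = id`, `dm = tdistT`, `D_i = kingTower`, `B_i = kingBlock`
and its five leaves are §2's theorems at every index and every (one-point) background; the socket's constants come out as
`(δ₀, a₀, B₀, θ) = (δ₄₅, 1, C_K, L⁻¹)`.  HONEST SCOPE: King's `A = 0` model — the backgrounds range over the one-point carrier, (3.35)∕(3.36) and the
guard `Msz·α₀ ≤ a₀` are idle (NOT why it holds); NOT Bałaban's `C^{(k)}(Λ; U)`; count-neutral. [cite: King1986, Lemma 4.5 (4.38) p.674 with (4.33)–(4.34), Lemma 4.3 (4.18) p.672, (4.41) p.675; Balaban1985BackgroundPropagators, Thm 3.15 (3.187) p.432 (quantifier template)] -/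
theorem ne2PlusUnit_king_of_socket (ha : 0 < a) (hm : 0 < m2) (hL : 2 ≤ L) (c35 : ℝ) :
    NE2PlusUnit c35 (kingInstance (d := d) (L := L)) (kingKer1 a m2) (fun _ _ => True) kingDist := by
  have hamin := aminL_pos ha hL
  have hLr : (1 : ℝ) < L := by exact_mod_cast hL
  have hθ : 0 < thetaBar a L * a := by unfold thetaBar; positivity
  have hr0 : 0 < ((L : ℝ) ^ 2)⁻¹ := by positivity
  have hr1 : ((L : ℝ) ^ 2)⁻¹ < 1 := inv_lt_one_of_one_lt₀ (by nlinarith)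
  refine N15unit_of_kingLeaves (c35 := c35) (pi := kingInstance (d := d) (L := L)) (Kd := kingKer1 a m2)
    (inΛ := fun _ _ => True) (unitDist := kingDist) (n := fun i => Tor (kingTor i)) one_pos
    (fun _ y => y) (fun i => tdistT (kingTor i)) (fun i _ => kingTower a m2 L i.Mn) (fun i _ => kingBlock a L i.Mn)
    (kingRho_add_lt_gam0L (dd := d + 1) ha hL) (kapCT_pos_le (d := d + 1) ha hL).1 hθ (CDelU_pos (d := d + 1) ha hamin)
    (V45_pos (d + 1) ha hL) hr0 hr1 (fun i => isPseudoMetric_tdistT (kingTor i)) (fun _ _ _ => le_rfl) fun i _ _ _ _ _ _ => ?_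
  refine ⟨uniformCoercive_kingTower ha hm hL, uniformCTBound_kingTower ha hm hL, uniformKernelDecay_kingTower ha hm hL,
    effectiveOperatorSupRate_kingTower ha hm hL, volumeSum_kingTorus ha hL, fun y y' => ?_⟩
  show kingCov L i.Mn a m2 (L ^ (i.k + 1)) (i.k + 1) y y' - kingCov L i.Mn a m2 (L ^ i.k) i.k y y'
    = (kingTower a m2 L i.Mn (i.k + 1) + kingBlock a L i.Mn)⁻¹ y y' - (kingTower a m2 L i.Mn i.k + kingBlock a L i.Mn)⁻¹ y y'
  rw [kingTower_of_one_le (by omega : 1 ≤ i.k + 1), kingTower_of_one_le i.one_le_k]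
  rfl

/-- … and the trivial-background unit layer `NE2ZeroUnit` for the one-step kernel (the lineage's bookkeeping `ne2ZeroUnit_of_ne2PlusUnit`).
[cite: King1986, Lemma 4.5 (4.38) p.674] -/
theorem ne2ZeroUnit_king_of_socket (ha : 0 < a) (hm : 0 < m2) (hL : 2 ≤ L) :
    NE2ZeroUnit (kingInstance (d := d) (L := L)) (kingKer1 a m2) (fun _ _ => True) kingDist :=
  ne2ZeroUnit_of_ne2PlusUnit (c35 := 0) (fun i => lt_of_lt_of_le one_pos i.one_le_Msz) (fun _ _ _ => trivial) (fun _ _ _ => trivial)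
    (ne2PlusUnit_king_of_socket ha hm hL 0)

end Socket

end Summit.QuantumFields.YangMills.BalabanUVNodes.N15.KingModel

end
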